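import Literature.NumberTheory.EllipticCurves.BhargavaShankarLocalWeightConstancyProofs
import Literature.NumberTheory.EllipticCurves.BinaryQuarticLocalSolubility
import Literature.NumberTheory.EllipticCurves.BinaryQuarticMinimisationTwoProofs
import HarnessLib

/-!
# The minimisation lemmas of Birch–Swinnerton-Dyer over `ℤ_p` (Bhargava–Shankar, Lemmas 5.3–5.5
# for `p`-adic forms), deduced from the integral versions by `p`-adic approximation

`Proofs` companion (theorems only: no definitions, no named facts) of
`BinaryQuarticMinimisation.lean`, whose three named facts `bsd_minimisation_prime_five_le`,
`bsd_minimisation_three`, `bsd_minimisation_two` (Bhargava–Shankar, *Binary quartic forms having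
bounded invariants, and the boundedness of the average rank of elliptic curves*, Ann. of Math. (2)
181 (2015) 191–242, Lemmas 5.3, 5.4, 5.5 of the held arXiv text `arXiv:1006.1002v2` = B. J. Birch,
H. P. F. Swinnerton-Dyer, *Notes on elliptic curves. I*, J. reine angew. Math. 212 (1963), Lemmas
3, 4, 5) are theorems of the tree for *integral* forms `f ∈ V_ℤ`
(`bsd_minimisation_prime_five_le_holds`, `bsd_minimisation_three_holds`,
`bsd_minimisation_two_holds`). The local computations of §5.2 of the source (Prop. 5.12: the
representatives `B_p^{I,J} ⊂ V_{ℤ_p}` of the soluble `PGL₂(ℚ_p)`-classes are taken *integral*;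
§3.2–3.3 of the published version) use the same lemmas for forms with coefficients in `ℤ_p` —
which is in fact the generality in which [BSD] and Stoll–Cremona (LMS J. Comput. Math. 5 (2002),
Appendix A: "The proof of [BSD, Lemma 3] for `ℚ_p` goes over unchanged") prove them. This file
transfers the three integral statements to `V_{ℤ_p}`:

* `BinaryQuartic.padic_minimisation_prime_five_le` — **`p ≥ 5`**: an `h ∈ V_{ℤ_p}` with
  `Δ(h) ≠ 0`, `p⁴ ∣ I(h)`, `p⁶ ∣ J(h)`, `ℚ_p`-soluble, is `ℚ_p`-equivalent (`KEquiv` in `V_{ℚ_p}`)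
  to an `h' ∈ V_{ℤ_p}` with invariants `(p⁻⁴ I(h), p⁻⁶ J(h))`;
* `BinaryQuartic.padic_minimisation_three` — **`p = 3`** under `3⁵ ∣ I(h)`, `3⁹ ∣ J(h)`;
* `BinaryQuartic.padic_minimisation_two` — **`p = 2`** under `2⁶ ∣ I(h)`, `2⁹ ∣ J(h)`,
  `2¹⁰ ∣ 8I(h) + J(h)`.

## The transfer argument (`padic_minimisation_of_int`)

Given `h ∈ V_{ℤ_p}` with `Δ(h) ≠ 0`, truncate its coefficients to integers: `f ∈ V_ℤ`,
`f ≡ h (mod p^N)` (`exists_int_congr`, Mathlib's `PadicInt.appr`). For `N` large, `f` is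
`ℚ_p`-soluble iff `h` is (`exists_pow_dvd_imp_isSoluble_iff`, local constancy of solubility off
`Δ = 0`), `I(f) ≡ I(h)`, `J(f) ≡ J(h)`, `Δ(f) ≡ Δ(h) (mod p^N)` (`dvd_I_add_smul_sub`, …), so the
integral lemma applies to `f` and yields `f' ∈ V_ℤ`, `f' = μ²·f((x,y)γ)` over `ℚ`, with invariants
`(p⁻⁴I(f), p⁻⁶J(f))`. By the Cartan decomposition (`exists_cartan_decomposition`)
`γ = c·k₁·diag(pⁿ,1)·k₂` with `kᵢ ∈ GL₂(ℤ_p)`, so `f' = λ·S(f)` with `λ = μ²c⁴` and the *integral*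
operator `S(g) = ((g∘k₂)∘diag(pⁿ,1))∘k₁` on `V_{ℤ_p}`; comparing invariants gives `|λ|_p = p^{2n+2}`
(`norm_lambda_eq`), and the integrality of `f' = λ S(f)` forces `p^{n+2} ∣ d`, `p^{2n+2} ∣ e` for
`f∘k₂`, whence `p^{2n+2} ∣ Δ(f)` (`sq_dvd_disc_of_dvd_d_of_sq_dvd_e`) and **`2n + 2 ≤ v_p(Δ(h))` is
bounded independently of `N`**. Taking `N ≥ 2n + 2`, the form `h' := λ·S(h) = f' + λ p^N S(w)`
(`h = f + p^N w`) is integral, `ℚ_p`-equivalent to `h` by the same `(μ, γ)`, and has invariants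
`(p⁻⁴I(h), p⁻⁶J(h))` by the same computation as for `f`.

## References

* M. Bhargava, A. Shankar, Ann. of Math. (2) 181 (2015) 191–242 = arXiv:1006.1002, Lemmas 5.3–5.5
  and the proof of Prop. 5.12 (`B_p^{I,J} ⊂ V_{ℤ_p}`) of the arXiv v2 text (§3.2–3.3 of the
  published version). [cite: BhargavaShankarAnnals2015, Lemmas 5.3–5.5 and Prop. 5.12 (arXiv:1006.1002v2 numbering)]
* M. Stoll, J. E. Cremona, *Minimal models for 2-coverings of elliptic curves*, LMS J. Comput.
  Math. 5 (2002) 220–243, Appendix A (the lemmas over `ℤ_p`). [cite: StollCremona2002, Appendix A]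
-/

noncomputable section

open scoped Classical
open Matrix

namespace Literature.NumberTheory.EllipticCurves

namespace BinaryQuartic

variable {p : ℕ} [Fact p.Prime]

/-! ## §1 Congruences: forms congruent modulo `t` have congruent invariants -/

section Congr

variable {R : Type*} [CommRing R]

/-- `f + t·w ≡ f` after reduction modulo `t`. [folklore] -/
theorem map_mk_add_smul (f w : BinaryQuartic R) (t : R) :
    (f + t • w).map (Ideal.Quotient.mk (Ideal.span {t})) = f.map (Ideal.Quotient.mk (Ideal.span {t})) := by
  have ht : Ideal.Quotient.mk (Ideal.span {t}) t = 0 :=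
    Ideal.Quotient.eq_zero_iff_mem.mpr (Ideal.mem_span_singleton_self t)
  ext <;> simp [map, ht]

/-- `t ∣ I(f + t·w) − I(f)`. [folklore] -/
theorem dvd_I_add_smul_sub (f w : BinaryQuartic R) (t : R) : t ∣ (f + t • w).I - f.I := by
  rw [← Ideal.mem_span_singleton, ← Ideal.Quotient.eq, ← I_map, ← I_map, map_mk_add_smul]

/-- `t ∣ J(f + t·w) − J(f)`. [folklore] -/
theorem dvd_J_add_smul_sub (f w : BinaryQuartic R) (t : R) : t ∣ (f + t • w).J - f.J := by
  rw [← Ideal.mem_span_singleton, ← Ideal.Quotient.eq, ← J_map, ← J_map, map_mk_add_smul]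

/-- `t ∣ Δ(f + t·w) − Δ(f)`. [folklore] -/
theorem dvd_disc_add_smul_sub (f w : BinaryQuartic R) (t : R) : t ∣ (f + t • w).disc - f.disc := by
  rw [← Ideal.mem_span_singleton, ← Ideal.Quotient.eq, ← disc_map, ← disc_map, map_mk_add_smul]

/-- A form all of whose coefficients are divisible by `t` is `t • Y`. [folklore] -/
theorem exists_eq_smul_of_dvd_coeffs {f : BinaryQuartic R} {t : R} (ha : t ∣ f.a) (hb : t ∣ f.b)
    (hc : t ∣ f.c) (hd : t ∣ f.d) (he : t ∣ f.e) : ∃ Y : BinaryQuartic R, f = t • Y := by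
  obtain ⟨a, ha⟩ := ha; obtain ⟨b, hb⟩ := hb; obtain ⟨c, hc⟩ := hc
  obtain ⟨d, hd⟩ := hd; obtain ⟨e, he⟩ := he
  exact ⟨⟨a, b, c, d, e⟩, by ext <;> simp [ha, hb, hc, hd, he]⟩

/-- Conversely the coefficients of `t • Y` are divisible by `t`. [folklore] -/
theorem dvd_coeffs_smul (t : R) (Y : BinaryQuartic R) :
    t ∣ (t • Y).a ∧ t ∣ (t • Y).b ∧ t ∣ (t • Y).c ∧ t ∣ (t • Y).d ∧ t ∣ (t • Y).e :=
  ⟨⟨Y.a, rfl⟩, ⟨Y.b, rfl⟩, ⟨Y.c, rfl⟩, ⟨Y.d, rfl⟩, ⟨Y.e, rfl⟩⟩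

/-- Substitution by a scalar multiple of a matrix: `f((x,y)(cM)) = c⁴ f((x,y)M)`. [folklore] -/
private theorem subst_smul_matrix_aux (f : BinaryQuartic R) (c : R) (M : Matrix (Fin 2) (Fin 2) R) :
    f.subst (c • M) = c ^ 4 • f.subst M := by
  ext <;> simp only [subst, Matrix.smul_apply, smul_eq_mul, smul_a, smul_b, smul_c, smul_d, smul_e] <;> ring

/-- Substitution of a negated form. [folklore] -/
theorem neg_smul_subst (f : BinaryQuartic R) (t : R) (γ : Matrix (Fin 2) (Fin 2) R) :
    ((-t) • f).subst γ = (-t) • f.subst γ := smul_subst _ _ _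

end Congr

/-! ## §2 Integers in `ℤ_p`: truncation and divisibility -/

/-- **Truncation**: every `h ∈ V_{ℤ_p}` is congruent modulo `p^N` to an integral form `f ∈ V_ℤ`
(density of `ℤ` in `ℤ_p`, Mathlib's `PadicInt.appr`). [folklore] -/
theorem exists_int_congr (h : BinaryQuartic ℤ_[p]) (N : ℕ) :
    ∃ f : BinaryQuartic ℤ, ∀ i, (p : ℤ_[p]) ^ N ∣ (f.map (Int.castRingHom ℤ_[p])).coeffs i - h.coeffs i := by
  have key : ∀ x : ℤ_[p], (p : ℤ_[p]) ^ N ∣ ((x.appr N : ℤ) : ℤ_[p]) - x := fun x ↦ by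
    have hx := Ideal.mem_span_singleton.mp (PadicInt.appr_spec N x)
    rw [← dvd_neg, neg_sub]
    simpa using hx
  refine ⟨⟨h.a.appr N, h.b.appr N, h.c.appr N, h.d.appr N, h.e.appr N⟩, fun i ↦ ?_⟩
  fin_cases i
  · simpa [coeffs, map] using key h.a
  · simpa [coeffs, map] using key h.b
  · simpa [coeffs, map] using key h.c
  · simpa [coeffs, map] using key h.d
  · simpa [coeffs, map] using key h.e

/-- `pⁿ ∣ k` in `ℤ_p` iff `pⁿ ∣ k` in `ℤ`, for an integer `k`.  DUPLICATE (dedup-00645) of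
Mathlib's `PadicInt.pow_p_dvd_int_iff` (arguments `(n) (a)`); kept only as a deprecated name. [folklore] -/
@[deprecated PadicInt.pow_p_dvd_int_iff (since := "2026-08-15")]
theorem padicInt_pow_dvd_intCast_iff (k : ℤ) (n : ℕ) :
    (p : ℤ_[p]) ^ n ∣ (k : ℤ_[p]) ↔ (p : ℤ) ^ n ∣ k :=
  PadicInt.pow_p_dvd_int_iff n k

/-- Divisibility by `pⁿ` in `ℤ_p` as a norm inequality. [folklore] -/
theorem padicInt_pow_dvd_iff_norm_le (x : ℤ_[p]) (n : ℕ) :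
    (p : ℤ_[p]) ^ n ∣ x ↔ ‖x‖ ≤ ((p : ℝ) ^ n)⁻¹ := by
  rw [← Ideal.mem_span_singleton, ← PadicInt.norm_le_pow_iff_mem_span_pow, _root_.zpow_neg, zpow_natCast]

/-- If `pᴺ ∣ y − x` and `‖x‖ > p⁻ᴺ` then `y ≠ 0`. [folklore] -/
theorem ne_zero_of_congr_of_norm_gt {x y : ℤ_[p]} {N : ℕ} (h : (p : ℤ_[p]) ^ N ∣ y - x)
    (hx : ((p : ℝ) ^ N)⁻¹ < ‖x‖) : y ≠ 0 := by
  rintro rfl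
  rw [zero_sub, dvd_neg, padicInt_pow_dvd_iff_norm_le] at h
  exact absurd h (not_le.mpr hx)

/-- If `pᴺ ∣ y − x` and `‖x‖ > p⁻ᴺ` then `‖y‖ = ‖x‖` (ultrametric). [folklore] -/
theorem norm_eq_of_congr_of_norm_gt {x y : ℤ_[p]} {N : ℕ} (h : (p : ℤ_[p]) ^ N ∣ y - x)
    (hx : ((p : ℝ) ^ N)⁻¹ < ‖x‖) : ‖y‖ = ‖x‖ := by
  rw [padicInt_pow_dvd_iff_norm_le] at h
  have hlt : ‖y - x‖ < ‖x‖ := lt_of_le_of_lt h hx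
  have key := PadicInt.norm_add_eq_max_of_ne (q := y - x) (r := x) hlt.ne
  rw [sub_add_cancel, max_eq_right hlt.le] at key
  exact key

/-- For `x ≠ 0` in `ℤ_p` there is `N` with `p⁻ᴺ < ‖x‖`. [folklore] -/
theorem exists_pow_inv_lt_norm {x : ℤ_[p]} (hx : x ≠ 0) : ∃ N : ℕ, ((p : ℝ) ^ N)⁻¹ < ‖x‖ := by
  obtain ⟨N, hN⟩ := PadicInt.exists_pow_neg_lt p (norm_pos_iff.mpr hx)
  exact ⟨N, by rwa [_root_.zpow_neg, zpow_natCast] at hN⟩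

/-- Monotonicity: `p⁻ᴹ ≤ p⁻ᴺ` for `N ≤ M`. [folklore] -/
theorem pow_inv_le_pow_inv {N M : ℕ} (h : N ≤ M) : ((p : ℝ) ^ M)⁻¹ ≤ ((p : ℝ) ^ N)⁻¹ := by
  have hp : (1 : ℝ) ≤ p := by exact_mod_cast (Fact.out : p.Prime).one_lt.le
  exact inv_anti₀ (by positivity) (pow_le_pow_right₀ hp h)

/-! ## §3 The integral operator `S(g) = ((g ∘ k₂) ∘ diag(pⁿ,1)) ∘ k₁` of a Cartan factorisation -/

/-- The diagonal Cartan factor over `ℚ_p` is the image of the integral one. [folklore] -/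
theorem diagPow_eq_map (n : ℕ) :
    (!![(p : ℚ_[p]) ^ n, 0; 0, 1] : Matrix (Fin 2) (Fin 2) ℚ_[p]) =
      (!![(p : ℤ_[p]) ^ n, 0; 0, 1] : Matrix (Fin 2) (Fin 2) ℤ_[p]).map PadicInt.Coe.ringHom := by
  ext i j; fin_cases i <;> fin_cases j <;> simp

/-- `S` commutes with `ℤ_p → ℚ_p`: `S(g) ⊗ ℚ_p = (g ⊗ ℚ_p)((x,y)·k₁ diag(pⁿ,1) k₂)`. [folklore] -/
theorem map_substS (g : BinaryQuartic ℤ_[p]) (k₁ k₂ : Matrix (Fin 2) (Fin 2) ℤ_[p]) (n : ℕ) :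
    (((g.subst k₂).subst !![(p : ℤ_[p]) ^ n, 0; 0, 1]).subst k₁).map PadicInt.Coe.ringHom =
      (g.map PadicInt.Coe.ringHom).subst
        (k₁.map PadicInt.Coe.ringHom * !![(p : ℚ_[p]) ^ n, 0; 0, 1] * k₂.map PadicInt.Coe.ringHom) := by
  rw [subst_mul, subst_mul, map_subst, map_subst, map_subst, diagPow_eq_map]

/-- `S` is additive. [folklore] -/
theorem substS_add (g w : BinaryQuartic ℤ_[p]) (k₁ k₂ D : Matrix (Fin 2) (Fin 2) ℤ_[p]) :
    (((g + w).subst k₂).subst D).subst k₁ = ((g.subst k₂).subst D).subst k₁ + ((w.subst k₂).subst D).subst k₁ := by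
  rw [subst_add, subst_add, subst_add]

/-- `S` commutes with scalars. [folklore] -/
theorem substS_smul (t : ℤ_[p]) (g : BinaryQuartic ℤ_[p]) (k₁ k₂ D : Matrix (Fin 2) (Fin 2) ℤ_[p]) :
    (((t • g).subst k₂).subst D).subst k₁ = t • ((g.subst k₂).subst D).subst k₁ := by
  rw [smul_subst, smul_subst, smul_subst]

/-- `I(S g) = det(k₁)⁴ det(k₂)⁴ p⁴ⁿ I(g)`. [folklore] -/
theorem I_substS (g : BinaryQuartic ℤ_[p]) (k₁ k₂ : Matrix (Fin 2) (Fin 2) ℤ_[p]) (n : ℕ) :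
    (((g.subst k₂).subst !![(p : ℤ_[p]) ^ n, 0; 0, 1]).subst k₁).I =
      k₁.det ^ 4 * k₂.det ^ 4 * ((p : ℤ_[p]) ^ n) ^ 4 * g.I := by
  rw [I_subst, I_subst, I_subst, Matrix.det_fin_two_of]; ring

/-- `J(S g) = det(k₁)⁶ det(k₂)⁶ p⁶ⁿ J(g)`. [folklore] -/
theorem J_substS (g : BinaryQuartic ℤ_[p]) (k₁ k₂ : Matrix (Fin 2) (Fin 2) ℤ_[p]) (n : ℕ) :
    (((g.subst k₂).subst !![(p : ℤ_[p]) ^ n, 0; 0, 1]).subst k₁).J =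
      k₁.det ^ 6 * k₂.det ^ 6 * ((p : ℤ_[p]) ^ n) ^ 6 * g.J := by
  rw [J_subst, J_subst, J_subst, Matrix.det_fin_two_of]; ring

/-- Undoing the outer factor: `S(g) ∘ k₁' = (g ∘ k₂) ∘ diag(pⁿ,1)` when `k₁'k₁ = 1`. [folklore] -/
theorem substS_subst_inv (g : BinaryQuartic ℤ_[p]) {k₁ k₁' : Matrix (Fin 2) (Fin 2) ℤ_[p]} (hk₁ : k₁' * k₁ = 1)
    (k₂ D : Matrix (Fin 2) (Fin 2) ℤ_[p]) :
    (((g.subst k₂).subst D).subst k₁).subst k₁' = (g.subst k₂).subst D := by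
  rw [← subst_mul, hk₁, subst_one]

/-- A matrix with a one-sided inverse over `ℤ_p` has unit determinant, of norm `1`. [folklore] -/
theorem norm_det_eq_one_of_mul_eq_one {k k' : Matrix (Fin 2) (Fin 2) ℤ_[p]} (h : k * k' = 1) : ‖k.det‖ = 1 := by
  apply PadicInt.isUnit_iff.mp
  have : k.det * k'.det = 1 := by rw [← Matrix.det_mul, h, Matrix.det_one]
  exact IsUnit.of_mul_eq_one _ this

/-- The same for a left inverse. [folklore] -/
theorem norm_det_eq_one_of_mul_eq_one' {k k' : Matrix (Fin 2) (Fin 2) ℤ_[p]} (h : k' * k = 1) : ‖k.det‖ = 1 := by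
  apply PadicInt.isUnit_iff.mp
  have : k.det * k'.det = 1 := by rw [mul_comm, ← Matrix.det_mul, h, Matrix.det_one]
  exact IsUnit.of_mul_eq_one _ this

/-! ## §4 The norm of the scalar `λ` -/

/-- Square roots of powers: `a² = q²ᵐ` with `a ≥ 0`, `q ≥ 0` forces `a = qᵐ`. [folklore] -/
theorem eq_pow_of_sq_eq {a q : ℝ} (ha : 0 ≤ a) (hq : 0 ≤ q) {m : ℕ} (h : a ^ 2 = q ^ (2 * m)) : a = q ^ m := by
  rw [pow_mul'] at h
  exact (pow_left_inj₀ ha (pow_nonneg hq _) two_ne_zero).mp h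

/-- Cube roots of powers: `a³ = q³ᵐ` with `a ≥ 0`, `q ≥ 0` forces `a = qᵐ`. [folklore] -/
theorem eq_pow_of_cube_eq {a q : ℝ} (ha : 0 ≤ a) (hq : 0 ≤ q) {m : ℕ} (h : a ^ 3 = q ^ (3 * m)) : a = q ^ m := by
  rw [pow_mul'] at h
  exact (pow_left_inj₀ ha (pow_nonneg hq _) (by norm_num)).mp h

/-- **The norm of `λ`.** If `F' = λ·S` in `V_{ℚ_p}` where `p⁴I(F') = I(F)`, `p⁶J(F') = J(F)`,
`I(S) = e₄ p⁴ⁿ I(F)`, `J(S) = e₆ p⁶ⁿ J(F)` with `|e₄| = |e₆| = 1` and `(I(F), J(F)) ≠ (0,0)`, then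
`|λ|_p = p^{2n+2}`. [folklore] -/
theorem norm_lambda_eq {lam IF JF IF' JF' IS JS e₄ e₆ : ℚ_[p]} {n : ℕ}
    (hIF' : IF' = lam ^ 2 * IS) (hJF' : JF' = lam ^ 3 * JS)
    (hIS : IS = e₄ * (p : ℚ_[p]) ^ (4 * n) * IF) (hJS : JS = e₆ * (p : ℚ_[p]) ^ (6 * n) * JF)
    (he₄ : ‖e₄‖ = 1) (he₆ : ‖e₆‖ = 1)
    (h4 : (p : ℚ_[p]) ^ 4 * IF' = IF) (h6 : (p : ℚ_[p]) ^ 6 * JF' = JF) (hne : IF ≠ 0 ∨ JF ≠ 0) :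
    ‖lam‖ = (p : ℝ) ^ (2 * n + 2) := by
  have hp0 : (p : ℚ_[p]) ≠ 0 := Nat.cast_ne_zero.mpr (Fact.out : p.Prime).ne_zero
  have hnp : ‖(p : ℚ_[p])‖ = (p : ℝ)⁻¹ := Padic.norm_p
  have hpR : (0 : ℝ) < p := by exact_mod_cast (Fact.out : p.Prime).pos
  rcases hne with hI | hJ
  · -- `p^{4n+4} λ² e₄ = 1`
    have key : (p : ℚ_[p]) ^ (4 * n + 4) * lam ^ 2 * e₄ = 1 := by
      have h1 : ((p : ℚ_[p]) ^ (4 * n + 4) * lam ^ 2 * e₄) * IF = 1 * IF := by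
        calc _ = (p : ℚ_[p]) ^ 4 * (lam ^ 2 * (e₄ * (p : ℚ_[p]) ^ (4 * n) * IF)) := by ring
          _ = (p : ℚ_[p]) ^ 4 * IF' := by rw [← hIS, ← hIF']
          _ = 1 * IF := by rw [h4, one_mul]
      exact mul_right_cancel₀ hI h1
    have hn := congrArg (fun z : ℚ_[p] ↦ ‖z‖) key
    simp only [norm_mul, norm_pow, norm_one, hnp, he₄, mul_one] at hn
    -- `‖λ‖² = p^{4n+4}`
    have hsq : ‖lam‖ ^ 2 = (p : ℝ) ^ (2 * (2 * n + 2)) := by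
      have hpow : ((p : ℝ)⁻¹) ^ (4 * n + 4) * (p : ℝ) ^ (4 * n + 4) = 1 := by
        rw [inv_pow, inv_mul_cancel₀ (pow_ne_zero _ hpR.ne')]
      calc ‖lam‖ ^ 2 = ((p : ℝ)⁻¹) ^ (4 * n + 4) * ‖lam‖ ^ 2 * (p : ℝ) ^ (4 * n + 4) := by
            rw [mul_comm _ (‖lam‖ ^ 2), mul_assoc, hpow, mul_one]
        _ = (p : ℝ) ^ (4 * n + 4) := by rw [hn, one_mul]
        _ = (p : ℝ) ^ (2 * (2 * n + 2)) := by ring_nf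
    exact eq_pow_of_sq_eq (norm_nonneg _) hpR.le hsq
  · have key : (p : ℚ_[p]) ^ (6 * n + 6) * lam ^ 3 * e₆ = 1 := by
      have h1 : ((p : ℚ_[p]) ^ (6 * n + 6) * lam ^ 3 * e₆) * JF = 1 * JF := by
        calc _ = (p : ℚ_[p]) ^ 6 * (lam ^ 3 * (e₆ * (p : ℚ_[p]) ^ (6 * n) * JF)) := by ring
          _ = (p : ℚ_[p]) ^ 6 * JF' := by rw [← hJS, ← hJF']
          _ = 1 * JF := by rw [h6, one_mul]
      exact mul_right_cancel₀ hJ h1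
    have hn := congrArg (fun z : ℚ_[p] ↦ ‖z‖) key
    simp only [norm_mul, norm_pow, norm_one, hnp, he₆, mul_one] at hn
    have hcube : ‖lam‖ ^ 3 = (p : ℝ) ^ (3 * (2 * n + 2)) := by
      have hpow : ((p : ℝ)⁻¹) ^ (6 * n + 6) * (p : ℝ) ^ (6 * n + 6) = 1 := by
        rw [inv_pow, inv_mul_cancel₀ (pow_ne_zero _ hpR.ne')]
      calc ‖lam‖ ^ 3 = ((p : ℝ)⁻¹) ^ (6 * n + 6) * ‖lam‖ ^ 3 * (p : ℝ) ^ (6 * n + 6) := by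
            rw [mul_comm _ (‖lam‖ ^ 3), mul_assoc, hpow, mul_one]
        _ = (p : ℝ) ^ (6 * n + 6) := by rw [hn, one_mul]
        _ = (p : ℝ) ^ (3 * (2 * n + 2)) := by ring_nf
    exact eq_pow_of_cube_eq (norm_nonneg _) hpR.le hcube

/-- From `|λ|_p = p^{m}`: `λ p^{m}` is a unit of `ℤ_p`. [folklore] -/
theorem exists_unit_of_norm_eq {lam : ℚ_[p]} {m : ℕ} (h : ‖lam‖ = (p : ℝ) ^ m) :
    ∃ u : ℤ_[p], IsUnit u ∧ PadicInt.Coe.ringHom u = lam * (p : ℚ_[p]) ^ m := by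
  have hpR : (0 : ℝ) < p := by exact_mod_cast (Fact.out : p.Prime).pos
  have hn : ‖lam * (p : ℚ_[p]) ^ m‖ = 1 := by
    rw [norm_mul, norm_pow, Padic.norm_p, h, inv_pow, mul_inv_cancel₀ (pow_ne_zero _ hpR.ne')]
  refine ⟨⟨lam * (p : ℚ_[p]) ^ m, hn.le⟩, ?_, rfl⟩
  exact PadicInt.isUnit_iff.mpr hn

/-! ## §5 Invariants: the cancellation `p^{4n}(p⁴ I' − I) = 0` -/

/-- **Invariant bookkeeping.** In a domain: if `t^{a} P^{4}·A' = κ t^{a} A`... concretely, from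
`P I'_f = κ I_f`, `q I'_f = I_f` with `P = q·r`, `r ≠ 0`, and the same shape `P I'_h = κ I_h` for
`h`, together with "`I_f = 0 → I_h = 0`", conclude `q I'_h = I_h`. [folklore] -/
theorem inv_transfer {R : Type*} [CommRing R] [IsDomain R] {q r κ If If' Ih Ih' : R} (hr : r ≠ 0)
    (hf : (q * r) * If' = κ * (r * If)) (hf' : q * If' = If) (hh : (q * r) * Ih' = κ * (r * Ih))
    (hzero : If = 0 → Ih = 0) : q * Ih' = Ih := by
  by_cases hI : If = 0
  · -- then `Ih = 0` and `(q r) Ih' = 0`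
    have hIh : Ih = 0 := hzero hI
    rw [hIh, mul_zero, mul_zero] at hh
    rcases mul_eq_zero.mp hh with hqr | hIh'
    · rcases mul_eq_zero.mp hqr with hq | hr'
      · rw [hq, zero_mul, hIh]
      · exact absurd hr' hr
    · rw [hIh', mul_zero, hIh]
  · -- `κ = 1`
    have hκ : κ = 1 := by
      have h1 : κ * (r * If) = 1 * (r * If) := by rw [← hf, ← hf']; ring
      exact mul_right_cancel₀ (mul_ne_zero hr hI) h1
    rw [hκ, one_mul] at hh
    have : r * (q * Ih') = r * Ih := by rw [← hh]; ring
    exact mul_left_cancel₀ hr this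

/-! ## §6 The transfer theorem -/

/-- **Minimisation over `ℤ_p` from minimisation over `ℤ`** (the engine of this file). Let
`h ∈ V_{ℤ_p}` with `Δ(h) ≠ 0` be `ℚ_p`-soluble, and suppose that every integral form `f ∈ V_ℤ`
congruent to `h` modulo `p^{N₀}` and `ℚ_p`-soluble is `ℚ`-equivalent to an integral form with
invariants `(p⁻⁴ I(f), p⁻⁶ J(f))` (the integral minimisation lemma, its divisibility hypotheses
being congruence conditions). Then `h` is `ℚ_p`-equivalent to an `h' ∈ V_{ℤ_p}` with invariants
`(p⁻⁴ I(h), p⁻⁶ J(h))`. [cite: BhargavaShankarAnnals2015, Lemmas 5.3–5.5 (arXiv:1006.1002v2 numbering), for p-adic forms] -/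
theorem padic_minimisation_of_int (h : BinaryQuartic ℤ_[p]) (hΔ : h.disc ≠ 0) {N₀ : ℕ}
    (HZ : ∀ f : BinaryQuartic ℤ,
      (∀ i, (p : ℤ_[p]) ^ N₀ ∣ (f.map (Int.castRingHom ℤ_[p])).coeffs i - h.coeffs i) →
      (f.map (Int.castRingHom ℚ_[p])).IsSoluble →
      ∃ f' : BinaryQuartic ℤ, KEquiv (f.map (Int.castRingHom ℚ)) (f'.map (Int.castRingHom ℚ)) ∧
        (p : ℤ) ^ 4 * f'.I = f.I ∧ (p : ℤ) ^ 6 * f'.J = f.J)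
    (hsol : (h.map PadicInt.Coe.ringHom).IsSoluble) :
    ∃ h' : BinaryQuartic ℤ_[p],
      KEquiv (h.map PadicInt.Coe.ringHom) (h'.map PadicInt.Coe.ringHom) ∧
        (p : ℤ_[p]) ^ 4 * h'.I = h.I ∧ (p : ℤ_[p]) ^ 6 * h'.J = h.J := by
  have hp0 : (p : ℤ_[p]) ≠ 0 := by exact_mod_cast (Fact.out : p.Prime).ne_zero
  have hpQ : (p : ℚ_[p]) ≠ 0 := Nat.cast_ne_zero.mpr (Fact.out : p.Prime).ne_zero
  have hpR : (0 : ℝ) < p := by exact_mod_cast (Fact.out : p.Prime).pos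
  -- ### the precision `N`
  obtain ⟨kS, hkS⟩ := exists_pow_dvd_imp_isSoluble_iff h hΔ
  obtain ⟨NΔ, hNΔ⟩ := exists_pow_inv_lt_norm hΔ
  have hexI : ∃ NI : ℕ, h.I ≠ 0 → ((p : ℝ) ^ NI)⁻¹ < ‖h.I‖ := by
    by_cases hI : h.I = 0
    · exact ⟨0, fun h' ↦ absurd hI h'⟩
    · obtain ⟨N, hN⟩ := exists_pow_inv_lt_norm hI; exact ⟨N, fun _ ↦ hN⟩
  have hexJ : ∃ NJ : ℕ, h.J ≠ 0 → ((p : ℝ) ^ NJ)⁻¹ < ‖h.J‖ := by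
    by_cases hJ : h.J = 0
    · exact ⟨0, fun h' ↦ absurd hJ h'⟩
    · obtain ⟨N, hN⟩ := exists_pow_inv_lt_norm hJ; exact ⟨N, fun _ ↦ hN⟩
  obtain ⟨NI, hNI⟩ := hexI
  obtain ⟨NJ, hNJ⟩ := hexJ
  set nΔ : ℕ := ⌊‖h.disc‖⁻¹⌋₊ with hnΔ
  set N : ℕ := N₀ + kS + NΔ + NI + NJ + (2 * nΔ + 2) with hN
  have hN₀ : N₀ ≤ N := by omega
  have hkSN : kS ≤ N := by omega
  have hNΔN : NΔ ≤ N := by omega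
  have hNIN : NI ≤ N := by omega
  have hNJN : NJ ≤ N := by omega
  have hnΔN : 2 * nΔ + 2 ≤ N := by omega
  have dvd_of_le : ∀ {m : ℕ} {x : ℤ_[p]}, m ≤ N → (p : ℤ_[p]) ^ N ∣ x → (p : ℤ_[p]) ^ m ∣ x :=
    fun hm hx ↦ (pow_dvd_pow _ hm).trans hx
  -- ### the truncation `f ≡ h (mod p^N)`
  obtain ⟨f, hf⟩ := exists_int_congr h N
  set fp : BinaryQuartic ℤ_[p] := f.map (Int.castRingHom ℤ_[p]) with hfp
  clear_value fp
  obtain ⟨w, hw⟩ := exists_eq_add_smul_of_congr hf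
  -- congruences of the invariants
  have hIc : (p : ℤ_[p]) ^ N ∣ fp.I - h.I := by rw [hw]; exact dvd_I_add_smul_sub _ _ _
  have hJc : (p : ℤ_[p]) ^ N ∣ fp.J - h.J := by rw [hw]; exact dvd_J_add_smul_sub _ _ _
  have hΔc : (p : ℤ_[p]) ^ N ∣ fp.disc - h.disc := by rw [hw]; exact dvd_disc_add_smul_sub _ _ _
  have hnormΔ : ‖fp.disc‖ = ‖h.disc‖ :=
    norm_eq_of_congr_of_norm_gt hΔc (lt_of_le_of_lt (pow_inv_le_pow_inv hNΔN) hNΔ)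
  have hΔf : fp.disc ≠ 0 := by
    rw [← norm_pos_iff, hnormΔ, norm_pos_iff]; exact hΔ
  have hIzero : fp.I = 0 → h.I = 0 := fun h0 ↦ by
    by_contra hI
    exact ne_zero_of_congr_of_norm_gt hIc (lt_of_le_of_lt (pow_inv_le_pow_inv hNIN) (hNI hI)) h0
  have hJzero : fp.J = 0 → h.J = 0 := fun h0 ↦ by
    by_contra hJ
    exact ne_zero_of_congr_of_norm_gt hJc (lt_of_le_of_lt (pow_inv_le_pow_inv hNJN) (hNJ hJ)) h0
  -- solubility of `f`
  have hsolf : (f.map (Int.castRingHom ℚ_[p])).IsSoluble := by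
    rw [← map_intCast_map_coe, ← hfp]
    exact (hkS fp fun i ↦ dvd_of_le hkSN (hf i)).mpr hsol
  -- ### the integral lemma
  have hf₀ : ∀ i, (p : ℤ_[p]) ^ N₀ ∣ (f.map (Int.castRingHom ℤ_[p])).coeffs i - h.coeffs i := fun i ↦ by
    rw [← hfp]; exact dvd_of_le hN₀ (hf i)
  obtain ⟨f', hK, hI4, hJ6⟩ := HZ f hf₀ hsolf
  -- over `ℚ_p`
  have hKp := KEquiv.map (Rat.castHom ℚ_[p]) hK
  have hmm : ∀ g : BinaryQuartic ℤ, (g.map (Int.castRingHom ℚ)).map (Rat.castHom ℚ_[p]) =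
      (g.map (Int.castRingHom ℤ_[p])).map PadicInt.Coe.ringHom := fun g ↦ by
    ext <;> simp [map]
  rw [hmm, hmm] at hKp
  set f'p : BinaryQuartic ℤ_[p] := f'.map (Int.castRingHom ℤ_[p]) with hf'p
  clear_value f'p
  obtain ⟨μ, hμ, γ, hγ, hEq⟩ := hKp
  rw [← hfp] at hEq
  -- ### Cartan
  obtain ⟨c, n, k₁, k₁', k₂, k₂', hc, hk₁, hk₂, hγeq⟩ := exists_cartan_decomposition hγ
  set D : Matrix (Fin 2) (Fin 2) ℤ_[p] := !![(p : ℤ_[p]) ^ n, 0; 0, 1] with hD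
  set lam : ℚ_[p] := μ ^ 2 * c ^ 4 with hlam
  -- `S g = ((g ∘ k₂) ∘ D) ∘ k₁`
  have hS : ∀ g : BinaryQuartic ℤ_[p], μ ^ 2 • (g.map PadicInt.Coe.ringHom).subst γ =
      lam • (((g.subst k₂).subst D).subst k₁).map PadicInt.Coe.ringHom := fun g ↦ by
    rw [hγeq, subst_smul_matrix_aux, map_substS, smul_smul]
  have hF' : f'p.map PadicInt.Coe.ringHom = lam • (((fp.subst k₂).subst D).subst k₁).map PadicInt.Coe.ringHom := by
    rw [← hS, ← hEq]
  -- ### `|λ| = p^{2n+2}`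
  have hdet₁ : ‖k₁.det‖ = 1 := norm_det_eq_one_of_mul_eq_one' hk₁
  have hdet₂ : ‖k₂.det‖ = 1 := norm_det_eq_one_of_mul_eq_one hk₂
  have hI4p : (p : ℤ_[p]) ^ 4 * f'p.I = fp.I := by
    have := congrArg (Int.castRingHom ℤ_[p]) hI4
    simpa [hf'p, hfp] using this
  have hJ6p : (p : ℤ_[p]) ^ 6 * f'p.J = fp.J := by
    have := congrArg (Int.castRingHom ℤ_[p]) hJ6
    simpa [hf'p, hfp] using this
  have hnormlam : ‖lam‖ = (p : ℝ) ^ (2 * n + 2) := by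
    have eI := congrArg BinaryQuartic.I hF'
    have eJ := congrArg BinaryQuartic.J hF'
    rw [I_smul, I_map, I_map, I_substS] at eI
    rw [J_smul, J_map, J_map, J_substS] at eJ
    refine norm_lambda_eq (IF := PadicInt.Coe.ringHom fp.I) (JF := PadicInt.Coe.ringHom fp.J)
      (e₄ := PadicInt.Coe.ringHom (k₁.det ^ 4 * k₂.det ^ 4)) (e₆ := PadicInt.Coe.ringHom (k₁.det ^ 6 * k₂.det ^ 6))
      (n := n) eI eJ ?_ ?_ ?_ ?_ ?_ ?_ ?_
    · simp only [map_mul, map_pow, map_natCast]; ring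
    · simp only [map_mul, map_pow, map_natCast]; ring
    · change ‖((k₁.det ^ 4 * k₂.det ^ 4 : ℤ_[p]) : ℚ_[p])‖ = 1
      rw [PadicInt.padic_norm_e_of_padicInt, norm_mul, norm_pow, norm_pow, hdet₁, hdet₂]; simp
    · change ‖((k₁.det ^ 6 * k₂.det ^ 6 : ℤ_[p]) : ℚ_[p])‖ = 1
      rw [PadicInt.padic_norm_e_of_padicInt, norm_mul, norm_pow, norm_pow, hdet₁, hdet₂]; simp
    · have := congrArg PadicInt.Coe.ringHom hI4p
      simpa only [map_mul, map_pow, map_natCast] using this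
    · have := congrArg PadicInt.Coe.ringHom hJ6p
      simpa only [map_mul, map_pow, map_natCast] using this
    · by_contra hboth
      rw [not_or, not_ne_iff, not_ne_iff] at hboth
      apply hΔf
      have h27 := twentySeven_mul_disc fp
      have hI0 : fp.I = 0 := PadicInt.coe_eq_zero.mp hboth.1
      have hJ0 : fp.J = 0 := PadicInt.coe_eq_zero.mp hboth.2
      rw [hI0, hJ0] at h27
      have : (27 : ℤ_[p]) * fp.disc = 0 := by rw [h27]; ring
      exact (mul_eq_zero.mp this).resolve_left (by norm_num)
  -- the unit `u = λ p^{2n+2}`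
  obtain ⟨u, hu, hucoe⟩ := exists_unit_of_norm_eq hnormlam
  set m : ℕ := 2 * n + 2 with hm
  -- ### the integral identity `p^m • f'p = u • S(fp)`
  have hcoepm : PadicInt.Coe.ringHom ((p : ℤ_[p]) ^ m) = (p : ℚ_[p]) ^ m := by
    rw [map_pow, map_natCast]
  have key_f : (p : ℤ_[p]) ^ m • f'p = u • ((fp.subst k₂).subst D).subst k₁ := by
    apply map_coe_injective
    rw [map_smul_form, map_smul_form, hF', smul_smul, hucoe, hcoepm, mul_comm]
  -- hence `p^m` divides the coefficients of `S(fp)`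
  obtain ⟨v, hv⟩ := hu
  have hSfp : ((fp.subst k₂).subst D).subst k₁ = (p : ℤ_[p]) ^ m • ((↑v⁻¹ : ℤ_[p]) • f'p) := by
    rw [smul_comm, key_f, smul_smul, ← hv, Units.inv_mul, one_smul]
  -- ### the bound `2n + 2 ≤ N` via `p^{2n+2} ∣ Δ(fp)`
  have hmN : m ≤ N := by
    -- `(fp ∘ k₂) ∘ D = S(fp) ∘ k₁'` has coefficients divisible by `p^m`
    set G : BinaryQuartic ℤ_[p] := fp.subst k₂ with hG
    have hGD : G.subst D = (p : ℤ_[p]) ^ m • (((↑v⁻¹ : ℤ_[p]) • f'p).subst k₁') := by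
      rw [← substS_subst_inv fp hk₁ k₂ D, hSfp, smul_subst]
    have hGD' := hGD
    rw [hD, subst_diagonal] at hGD'
    have hd : (p : ℤ_[p]) ^ m ∣ G.d * (p : ℤ_[p]) ^ n := by
      have := congrArg BinaryQuartic.d hGD'
      simp only [one_pow, mul_one, smul_d] at this
      exact ⟨_, this⟩
    have he : (p : ℤ_[p]) ^ m ∣ G.e := by
      have := congrArg BinaryQuartic.e hGD'
      simp only [one_pow, mul_one, smul_e] at this
      exact ⟨_, this⟩
    -- `p^{n+1} ∣ G.d` and `(p^{n+1})² ∣ G.e`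
    have hd' : (p : ℤ_[p]) ^ (n + 1) ∣ G.d := by
      have h1 : (p : ℤ_[p]) ^ (n + 2) * (p : ℤ_[p]) ^ n ∣ G.d * (p : ℤ_[p]) ^ n := by
        rw [← pow_add, show n + 2 + n = m by omega]; exact hd
      have h2 : (p : ℤ_[p]) ^ (n + 2) ∣ G.d := (mul_dvd_mul_iff_right (pow_ne_zero n hp0)).mp h1
      exact (pow_dvd_pow _ (by omega)).trans h2
    have he' : ((p : ℤ_[p]) ^ (n + 1)) ^ 2 ∣ G.e := by rw [← pow_mul, show (n + 1) * 2 = m by omega]; exact he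
    have hΔG : ((p : ℤ_[p]) ^ (n + 1)) ^ 2 ∣ G.disc := sq_dvd_disc_of_dvd_d_of_sq_dvd_e G hd' he'
    -- norms
    have hnG : ‖G.disc‖ = ‖h.disc‖ := by
      rw [← hnormΔ, hG, disc_subst, norm_mul, norm_pow, hdet₂, one_pow, one_mul]
    have hle : ‖h.disc‖ ≤ ((p : ℝ) ^ (n + 1))⁻¹ ^ 2 := by
      rw [← hnG, inv_pow, ← pow_mul]
      rw [← pow_mul] at hΔG
      exact (padicInt_pow_dvd_iff_norm_le _ _).mp hΔG
    have hfl := le_floor_of_norm_le hΔ hle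
    rw [← hnΔ] at hfl
    omega
  -- ### `S(h)` is divisible by `p^m`
  have hSh : ∃ Y : BinaryQuartic ℤ_[p], ((h.subst k₂).subst D).subst k₁ = (p : ℤ_[p]) ^ m • Y := by
    have hh : h = fp + (p : ℤ_[p]) ^ N • (-w) := by
      rw [hw, smul_neg, add_neg_cancel_right]
    obtain ⟨q, hq⟩ : (p : ℤ_[p]) ^ m ∣ (p : ℤ_[p]) ^ N := pow_dvd_pow _ hmN
    refine ⟨(↑v⁻¹ : ℤ_[p]) • f'p + q • ((((-w).subst k₂).subst D).subst k₁), ?_⟩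
    rw [hh, substS_add, substS_smul, hSfp, hq, smul_add, mul_smul]
  obtain ⟨Y, hY⟩ := hSh
  -- ### the form `h' = u • Y`
  refine ⟨u • Y, ⟨μ, hμ, γ, hγ, ?_⟩, ?_, ?_⟩
  · -- `K`-equivalence: `(u • Y) ⊗ ℚ_p = μ² • (h ⊗ ℚ_p)((x,y)γ)`
    rw [hS h, hY, map_smul_form, map_smul_form, smul_smul, hucoe, hcoepm]
  · -- `p⁴ I(h') = I(h)`
    have ef := congrArg BinaryQuartic.I key_f
    have eh := congrArg BinaryQuartic.I hY
    rw [I_smul, I_smul, I_substS] at ef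
    rw [I_substS, I_smul] at eh
    -- shapes: `(p^m)^2 I(f'p) = u^2 k p^{4n} I(fp)` and `k p^{4n} I(h) = (p^m)^2 I(Y)`
    have hr : ((p : ℤ_[p]) ^ n) ^ 4 ≠ 0 := pow_ne_zero _ (pow_ne_zero _ hp0)
    have hpm : ((p : ℤ_[p]) ^ m) ^ 2 = (p : ℤ_[p]) ^ 4 * ((p : ℤ_[p]) ^ n) ^ 4 := by
      rw [← pow_mul, ← pow_mul, ← pow_add]; congr 1; omega
    have e1 : ((p : ℤ_[p]) ^ 4 * ((p : ℤ_[p]) ^ n) ^ 4) * f'p.I =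
        (u ^ 2 * (k₁.det ^ 4 * k₂.det ^ 4)) * (((p : ℤ_[p]) ^ n) ^ 4 * fp.I) := by
      rw [← hpm]; linear_combination ef
    have e2 : ((p : ℤ_[p]) ^ 4 * ((p : ℤ_[p]) ^ n) ^ 4) * (u • Y).I =
        (u ^ 2 * (k₁.det ^ 4 * k₂.det ^ 4)) * (((p : ℤ_[p]) ^ n) ^ 4 * h.I) := by
      rw [← hpm, I_smul]; linear_combination u ^ 2 * eh.symm
    exact inv_transfer hr e1 hI4p e2 hIzero
  · -- `p⁶ J(h') = J(h)`
    have ef := congrArg BinaryQuartic.J key_f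
    have eh := congrArg BinaryQuartic.J hY
    rw [J_smul, J_smul, J_substS] at ef
    rw [J_substS, J_smul] at eh
    have hr : ((p : ℤ_[p]) ^ n) ^ 6 ≠ 0 := pow_ne_zero _ (pow_ne_zero _ hp0)
    have hpm : ((p : ℤ_[p]) ^ m) ^ 3 = (p : ℤ_[p]) ^ 6 * ((p : ℤ_[p]) ^ n) ^ 6 := by
      rw [← pow_mul, ← pow_mul, ← pow_add]; congr 1; omega
    have e1 : ((p : ℤ_[p]) ^ 6 * ((p : ℤ_[p]) ^ n) ^ 6) * f'p.J =
        (u ^ 3 * (k₁.det ^ 6 * k₂.det ^ 6)) * (((p : ℤ_[p]) ^ n) ^ 6 * fp.J) := by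
      rw [← hpm]; linear_combination ef
    have e2 : ((p : ℤ_[p]) ^ 6 * ((p : ℤ_[p]) ^ n) ^ 6) * (u • Y).J =
        (u ^ 3 * (k₁.det ^ 6 * k₂.det ^ 6)) * (((p : ℤ_[p]) ^ n) ^ 6 * h.J) := by
      rw [← hpm, J_smul]; linear_combination u ^ 3 * eh.symm
    exact inv_transfer hr e1 hJ6p e2 hJzero

/-! ## §7 The three minimisation lemmas over `ℤ_p` -/

/-- Divisibility of `I(f)` in `ℤ` from a congruence `f ≡ h (mod p^M)` in `V_{ℤ_p}` and
`p^a ∣ I(h)`, `a ≤ M`. [folklore] -/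
theorem int_pow_dvd_I_of_congr {h : BinaryQuartic ℤ_[p]} {f : BinaryQuartic ℤ} {M a : ℕ} (ha : a ≤ M)
    (hf : ∀ i, (p : ℤ_[p]) ^ M ∣ (f.map (Int.castRingHom ℤ_[p])).coeffs i - h.coeffs i)
    (hI : (p : ℤ_[p]) ^ a ∣ h.I) : (p : ℤ) ^ a ∣ f.I := by
  obtain ⟨w, hw⟩ := exists_eq_add_smul_of_congr hf
  have hc : (p : ℤ_[p]) ^ a ∣ (f.map (Int.castRingHom ℤ_[p])).I - h.I :=
    (pow_dvd_pow _ ha).trans (by rw [hw]; exact dvd_I_add_smul_sub _ _ _)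
  have : (p : ℤ_[p]) ^ a ∣ (f.map (Int.castRingHom ℤ_[p])).I := by simpa using dvd_add hc hI
  rw [I_map, eq_intCast] at this
  exact (PadicInt.pow_p_dvd_int_iff _ _).mp this

/-- The same for `J`. [folklore] -/
theorem int_pow_dvd_J_of_congr {h : BinaryQuartic ℤ_[p]} {f : BinaryQuartic ℤ} {M a : ℕ} (ha : a ≤ M)
    (hf : ∀ i, (p : ℤ_[p]) ^ M ∣ (f.map (Int.castRingHom ℤ_[p])).coeffs i - h.coeffs i)
    (hJ : (p : ℤ_[p]) ^ a ∣ h.J) : (p : ℤ) ^ a ∣ f.J := by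
  obtain ⟨w, hw⟩ := exists_eq_add_smul_of_congr hf
  have hc : (p : ℤ_[p]) ^ a ∣ (f.map (Int.castRingHom ℤ_[p])).J - h.J :=
    (pow_dvd_pow _ ha).trans (by rw [hw]; exact dvd_J_add_smul_sub _ _ _)
  have : (p : ℤ_[p]) ^ a ∣ (f.map (Int.castRingHom ℤ_[p])).J := by simpa using dvd_add hc hJ
  rw [J_map, eq_intCast] at this
  exact (PadicInt.pow_p_dvd_int_iff _ _).mp this

/-- The same for `8I + J`. [folklore] -/
theorem int_pow_dvd_eightI_add_J_of_congr {h : BinaryQuartic ℤ_[p]} {f : BinaryQuartic ℤ} {M a : ℕ} (ha : a ≤ M)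
    (hf : ∀ i, (p : ℤ_[p]) ^ M ∣ (f.map (Int.castRingHom ℤ_[p])).coeffs i - h.coeffs i)
    (hIJ : (p : ℤ_[p]) ^ a ∣ 8 * h.I + h.J) : (p : ℤ) ^ a ∣ 8 * f.I + f.J := by
  obtain ⟨w, hw⟩ := exists_eq_add_smul_of_congr hf
  have hcI : (p : ℤ_[p]) ^ a ∣ (f.map (Int.castRingHom ℤ_[p])).I - h.I :=
    (pow_dvd_pow _ ha).trans (by rw [hw]; exact dvd_I_add_smul_sub _ _ _)
  have hcJ : (p : ℤ_[p]) ^ a ∣ (f.map (Int.castRingHom ℤ_[p])).J - h.J :=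
    (pow_dvd_pow _ ha).trans (by rw [hw]; exact dvd_J_add_smul_sub _ _ _)
  have : (p : ℤ_[p]) ^ a ∣ 8 * (f.map (Int.castRingHom ℤ_[p])).I + (f.map (Int.castRingHom ℤ_[p])).J := by
    have := dvd_add (dvd_add (dvd_mul_of_dvd_right hcI 8) hcJ) hIJ
    convert this using 1; ring
  rw [I_map, J_map, eq_intCast, eq_intCast] at this
  have h8 : (8 * (f.I : ℤ_[p]) + (f.J : ℤ_[p])) = ((8 * f.I + f.J : ℤ) : ℤ_[p]) := by push_cast; ring
  rw [h8] at this
  exact (PadicInt.pow_p_dvd_int_iff _ _).mp this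

/-- **Bhargava–Shankar, Lemma 5.3, for `p`-adic forms** (Birch–Swinnerton-Dyer, Lemma 3; `p ≥ 5`):
an `h ∈ V_{ℤ_p}` with `Δ(h) ≠ 0`, `p⁴ ∣ I(h)`, `p⁶ ∣ J(h)` such that `z² = h(x,y)` is soluble over
`ℚ_p` is `ℚ_p`-equivalent to an `h' ∈ V_{ℤ_p}` with invariants `p⁻⁴ I(h)`, `p⁻⁶ J(h)`.
[cite: BhargavaShankarAnnals2015, Lemma 5.3 (arXiv:1006.1002v2 numbering), p-adic coefficients] -/
theorem padic_minimisation_prime_five_le (hp : 5 ≤ p) (h : BinaryQuartic ℤ_[p]) (hΔ : h.disc ≠ 0)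
    (hI : (p : ℤ_[p]) ^ 4 ∣ h.I) (hJ : (p : ℤ_[p]) ^ 6 ∣ h.J) (hsol : (h.map PadicInt.Coe.ringHom).IsSoluble) :
    ∃ h' : BinaryQuartic ℤ_[p],
      KEquiv (h.map PadicInt.Coe.ringHom) (h'.map PadicInt.Coe.ringHom) ∧
        (p : ℤ_[p]) ^ 4 * h'.I = h.I ∧ (p : ℤ_[p]) ^ 6 * h'.J = h.J :=
  padic_minimisation_of_int h hΔ (N₀ := 6) (fun f hf hsolf ↦
    bsd_minimisation_prime_five_le_holds p hp f (int_pow_dvd_I_of_congr (by norm_num) hf hI)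
      (int_pow_dvd_J_of_congr le_rfl hf hJ) hsolf) hsol

/-- **Bhargava–Shankar, Lemma 5.4, for `3`-adic forms** (Birch–Swinnerton-Dyer, Lemma 4): an
`h ∈ V_{ℤ₃}` with `Δ(h) ≠ 0`, `3⁵ ∣ I(h)`, `3⁹ ∣ J(h)`, soluble over `ℚ₃`, is `ℚ₃`-equivalent to an
`h' ∈ V_{ℤ₃}` with invariants `3⁻⁴ I(h)`, `3⁻⁶ J(h)`. [cite: BhargavaShankarAnnals2015, Lemma 5.4 (arXiv:1006.1002v2 numbering), 3-adic coefficients] -/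
theorem padic_minimisation_three [Fact (Nat.Prime 3)] (h : BinaryQuartic ℤ_[3]) (hΔ : h.disc ≠ 0)
    (hI : (3 : ℤ_[3]) ^ 5 ∣ h.I) (hJ : (3 : ℤ_[3]) ^ 9 ∣ h.J) (hsol : (h.map PadicInt.Coe.ringHom).IsSoluble) :
    ∃ h' : BinaryQuartic ℤ_[3],
      KEquiv (h.map PadicInt.Coe.ringHom) (h'.map PadicInt.Coe.ringHom) ∧
        (3 : ℤ_[3]) ^ 4 * h'.I = h.I ∧ (3 : ℤ_[3]) ^ 6 * h'.J = h.J := by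
  have hI' : ((3 : ℕ) : ℤ_[3]) ^ 5 ∣ h.I := by simpa using hI
  have hJ' : ((3 : ℕ) : ℤ_[3]) ^ 9 ∣ h.J := by simpa using hJ
  have := padic_minimisation_of_int (p := 3) h hΔ (N₀ := 9) (fun f hf hsolf ↦
    bsd_minimisation_three_holds f (by simpa using int_pow_dvd_I_of_congr (by norm_num) hf hI')
      (by simpa using int_pow_dvd_J_of_congr le_rfl hf hJ') hsolf) hsol
  simpa using this

/-- **Bhargava–Shankar, Lemma 5.5, for `2`-adic forms** (Birch–Swinnerton-Dyer, Lemma 5): an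
`h ∈ V_{ℤ₂}` with `Δ(h) ≠ 0`, `2⁶ ∣ I(h)`, `2⁹ ∣ J(h)`, `2¹⁰ ∣ 8I(h) + J(h)`, soluble over `ℚ₂`, is
`ℚ₂`-equivalent to an `h' ∈ V_{ℤ₂}` with invariants `2⁻⁴ I(h)`, `2⁻⁶ J(h)`.
[cite: BhargavaShankarAnnals2015, Lemma 5.5 (arXiv:1006.1002v2 numbering), 2-adic coefficients] -/
theorem padic_minimisation_two [Fact (Nat.Prime 2)] (h : BinaryQuartic ℤ_[2]) (hΔ : h.disc ≠ 0)
    (hI : (2 : ℤ_[2]) ^ 6 ∣ h.I) (hJ : (2 : ℤ_[2]) ^ 9 ∣ h.J) (hIJ : (2 : ℤ_[2]) ^ 10 ∣ 8 * h.I + h.J)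
    (hsol : (h.map PadicInt.Coe.ringHom).IsSoluble) :
    ∃ h' : BinaryQuartic ℤ_[2],
      KEquiv (h.map PadicInt.Coe.ringHom) (h'.map PadicInt.Coe.ringHom) ∧
        (2 : ℤ_[2]) ^ 4 * h'.I = h.I ∧ (2 : ℤ_[2]) ^ 6 * h'.J = h.J := by
  have hI' : ((2 : ℕ) : ℤ_[2]) ^ 6 ∣ h.I := by simpa using hI
  have hJ' : ((2 : ℕ) : ℤ_[2]) ^ 9 ∣ h.J := by simpa using hJ
  have hIJ' : ((2 : ℕ) : ℤ_[2]) ^ 10 ∣ 8 * h.I + h.J := by simpa using hIJ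
  have := padic_minimisation_of_int (p := 2) h hΔ (N₀ := 10) (fun f hf hsolf ↦
    bsd_minimisation_two_holds f (by simpa using int_pow_dvd_I_of_congr (by norm_num) hf hI')
      (by simpa using int_pow_dvd_J_of_congr (by norm_num) hf hJ')
      (by simpa using int_pow_dvd_eightI_add_J_of_congr le_rfl hf hIJ') hsolf) hsol
  simpa using this

end BinaryQuartic

end Literature.NumberTheory.EllipticCurves

end
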